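import Literature.AnabelianGeometry.EtaleTheta.Discharge.Sec1DtpYEllZHat
import Literature.AnabelianGeometry.EtaleTheta.Discharge.Sec2DtpYThetaAbelianCorollaries
import Literature.AnabelianGeometry.EtaleTheta.Discharge.Sec1Thm16GKNTate
import Literature.AnabelianGeometry.EtaleTheta.ThetaCyclotomes
import Literature.AnabelianGeometry.EtaleTheta.CyclotomeZHatAction
import HarnessLib

/-!
# [EtTh] §1 p. 13 «(Δ^tp_Y)^ell ≅ Ẑ(1)»: the Tate-module origin clause `IsTateOrigin.tate` DERIVED (two of
# its three parts) from the freeness guard, the closedness binder `hYcl` and a mod-`N` cyclotome datum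

Mochizuki, *The étale theta function and its Frobenioid-theoretic manifestations*, Publ. RIMS **45** (2009)
[EtTh], §1, PRIMS PDF p. 13 (printed 239): "`1 → (Δ^tp_Y)^ell ⊗ ℤ/Nℤ → Gal(Y_N/Y) → Gal(K_N/K) → 1` … [Indeed,
this follows from the fact that `G_{K_N}` acts trivially on `(Δ^tp_X)^ell/N·(Δ^tp_Y)^ell`.]", resting on p. 12
"`(Δ^tp_Y)^ell ≅ Ẑ(1)`" [cite: MochizukiEtTh2009, §1 p.13].  Layer L2 of the abc-iut cell, seat abc-iut-L2-t7
(gen 3); PROOF-ONLY (no `def`, no `instance`, no named fact); nothing of another seat edited or restated — an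
INPUT file for the K3 sub-DAG (leaf L04, `Thm16Sub.gknIsKernelOfAction_of_tate`, abc-iut-w5-d051 / abc-iut-L6-d5).

The origin clause `ThetaSetting.IsTateOrigin.tate` (abc-iut-L2-t6, `ThetaSettingOriginClauses.lean`) feeds
`gknIsKernelOfAction_of_tate` three hypotheses: `hord` («`toEll y₁ ^ k ∈ N·(Δ^tp_Y)^ell ↔ N ∣ k`»), `htw` (the
TATE TWIST: `aug g ζ_N = ζ_N^k ⇒ (g y g⁻¹)^ell ≡ (y^ell)^k mod N`) and `hkum` (the Kummer class of `q_X`).  Here the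
first two are PROVED from binders already in the census, for every `D : ThetaSetting p`:
* `ThetaSetting.IsEtThOrigin.exists_generator_hord` — under `IsEtThOrigin` + `hYcl` (GAP-LEDGER G-w4d021-2):
  a `y₁ ∈ Δ^tp_Y` with, for EVERY `N ≥ 1`, the cyclicity clause `∀ y ∈ Δ^tp_Y, ∃ k, toEll y · (toEll y₁^k)⁻¹ ∈
  N·(Δ^tp_Y)^ell` and `hord` — from abc-iut-w5-d006's tempered `Λ : Δ^tp_Y ↠ Ẑ` with kernel `Ker toEll`
  (`exists_hom_dtpY_zHat`) and `Ker(Ẑ → ℤ/N) = Ẑ^N` (`ZHatLevel.level_eq_one_iff_exists_pow`);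
* `ThetaSetting.IsEtThOrigin.tate_twist_of_cyclotomeMod` — under `IsEtThOrigin` + `hYcl` + a datum
  `μ : D.CyclotomeMod 1 N` (abc-iut-L2-t8's typed "`Δ_Θ ⊗ ℤ/N ≅ μ_N`, `G_K`-equivariantly", GAP G-L2t10-1,
  witnessed at the χ-model): the clause `htw` — via the COMMUTATOR PAIRING `y ↦ θ[z, y] : Δ^tp_Y → Δ_Θ`
  (`z ↦ 1 ∈ Z`): a homomorphism (centrality of `Δ_Θ`), with kernel `Ker toEll ∩ Δ^tp_Y` (abc-iut-w5-d006's
  non-degeneracy `toHat_mem_commutatorClosure_of_commutator_mem`), ONTO `Δ_Θ` (abc-iut-L5-t14's Heisenberg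
  surjectivity, `exists_commutator_of_mem_deltaTheta_of_origin`), and `Π^tp_X`-EQUIVARIANT (abc-iut-L2-t8's
  `dtpYTheta_comm`) — along which `μ.red_conj` transports the cyclotomic character to `(Δ^tp_Y)^ell`.
Net effect for K3/L04: `GKNIsKernelOfAction D N ⟸ {IsEtThOrigin, hYcl, CyclotomeMod 1 N, hkum}` — the origin
clause shrinks to its genuinely arithmetic third (the Kummer class of the Tate period `q_X`).  This is the CONVERSE
of abc-iut-w5-d187's `Discharge/Sec1DeltaThetaTateTwist.lean` / `Sec1CyclotomeModOfTate.lean` (the Tate twist of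
`Δ_Θ`, i.e. a `CyclotomeMod`, FROM the clause `IsTateOrigin.tate`); together: modulo `hYcl` and the Kummer clause, the
two mod-`N` Tate-twist statements of p. 12 — for `Δ_Θ` and for `(Δ^tp_Y)^ell` — are EQUIVALENT over the root.

HONEST FRAMING: [EtTh] is refereed; the theta setting is DATA quoting print, asserted for no curve; `hYcl` and the
cyclotome datum are HYPOTHESES (binders), never asserted; nothing here bears on [IUTchIII] Cor. 3.12; typed ≠
proved elsewhere; no side is taken on any disputed claim.
-/

noncomputable section

namespace Literature.AnabelianGeometry.EtaleTheta

open Literature.AnabelianGeometry.SemiGraphs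
open _root_.Topology
open scoped commutatorElement
open CategoryTheory ProfiniteGrp ProfiniteGrp.ProfiniteCompletion ClassTwo

namespace ThetaSetting

variable {p : ℕ} [Fact p.Prime] (D : ThetaSetting p)

/-! ### Part A: cyclicity and the order clause `hord` from `(Δ^tp_Y)^ell ≅ Ẑ` -/

/-- **The order clause `hord` and the cyclicity clause of `IsTateOrigin.tate`, DERIVED** ([EtTh] p. 13
"`(Δ^tp_Y)^ell ⊗ ℤ/Nℤ`", p. 12 "`(Δ^tp_Y)^ell ≅ Ẑ(1)`"): under the freeness guard and the closedness binder `hYcl`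
there is `y₁ ∈ Δ^tp_Y` such that for EVERY `N ≥ 1`: every `y ∈ Δ^tp_Y` satisfies
`toEll y · (toEll y₁^k)⁻¹ ∈ N·(Δ^tp_Y)^ell` for some `k`, and `toEll y₁^k ∈ N·(Δ^tp_Y)^ell ↔ N ∣ k` — i.e.
`(Δ^tp_Y)^ell/N` is cyclic of order `N` generated by `y₁` (a topological generator of `(Δ^tp_Y)^ell ≅ Ẑ`, mapped
to `η(1)` by abc-iut-w5-d006's `Λ`). [cite: MochizukiEtTh2009, §1 p.13] -/
theorem IsEtThOrigin.exists_generator_hord (hO : D.IsEtThOrigin)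
    (hYcl : (D.DtpY.map D.toHat.toMonoidHom).topologicalClosure ≤
      D.DtpY.map D.toHat.toMonoidHom ⊔ (⁅⁅D.DeltaHat, D.DeltaHat⁆, D.DeltaHat⁆).topologicalClosure) :
    ∃ y₁ ∈ D.DtpY, ∀ N : ℕ+,
      (∀ y ∈ D.DtpY, ∃ k : ℕ,
        Thm16Sub.toEll D y * (Thm16Sub.toEll D y₁ ^ k)⁻¹ ∈ Thm16Sub.ellPowersY D N) ∧
      (∀ k : ℕ, Thm16Sub.toEll D y₁ ^ k ∈ Thm16Sub.ellPowersY D N ↔ (N : ℕ) ∣ k) := by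
  classical
  obtain ⟨Λ, hΛs, hΛk⟩ := hO.exists_hom_dtpY_zHat D hYcl
  obtain ⟨y₁, hy₁⟩ := hΛs (ZHatLevel.eta 1)
  refine ⟨(y₁ : D.PiTemp), y₁.2, fun N => ?_⟩
  haveI : NeZero (N : ℕ) := ⟨N.ne_zero⟩
  -- `Λ (w) = η(k)` bookkeeping
  have hΛpow : ∀ k : ℕ, Λ (y₁ ^ k) = ZHatLevel.eta (k : ℤ) := fun k => by
    rw [map_pow, hy₁, ZHatLevel.eta_eq_zpow (k : ℤ), zpow_natCast]
  -- the kernel clause, in `toEll` form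
  have hker : ∀ w : ↥D.DtpY, Λ w = 1 ↔ Thm16Sub.toEll D (w : D.PiTemp) = 1 := fun w => by
    rw [hΛk w, MonoidHom.mem_ker]
  -- every element of `N·(Δ^tp_Y)^ell` is `toEll w` with `Λ w ∈ Ẑ^N`
  have hclos : ∀ x ∈ Thm16Sub.ellPowersY D N, ∃ w : ↥D.DtpY,
      Thm16Sub.toEll D (w : D.PiTemp) = x ∧ ZHatLevel.level N (Λ w) = 1 := by
    intro x hx
    refine Subgroup.closure_induction (p := fun x _ => ∃ w : ↥D.DtpY,
      Thm16Sub.toEll D (w : D.PiTemp) = x ∧ ZHatLevel.level N (Λ w) = 1) ?_ ?_ ?_ ?_ hx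
    · rintro _ ⟨_, ⟨y, hy, rfl⟩, rfl⟩
      refine ⟨⟨y, hy⟩ ^ (N : ℕ), ?_, ?_⟩
      · rw [Subgroup.coe_pow, map_pow]
      · rw [map_pow, ZHatLevel.level_pow_self]
    · exact ⟨1, by rw [OneMemClass.coe_one, map_one], by rw [map_one, map_one]⟩
    · rintro x y _ _ ⟨w, hw, hwl⟩ ⟨w', hw', hwl'⟩
      exact ⟨w * w', by rw [Subgroup.coe_mul, map_mul, hw, hw'], by rw [map_mul, map_mul, hwl, hwl', mul_one]⟩
    · rintro x _ ⟨w, hw, hwl⟩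
      exact ⟨w⁻¹, by rw [Subgroup.coe_inv, map_inv, hw], by rw [map_inv, map_inv, hwl, inv_one]⟩
  refine ⟨fun y hy => ?_, fun k => ⟨fun hk => ?_, fun hk => ?_⟩⟩
  · -- cyclicity: `Λ y ≡ η(k) mod Ẑ^N` for some `k : ℕ`
    obtain ⟨k₀, hk₀⟩ := ZHatLevel.exists_level_eq_level_eta N (Λ ⟨y, hy⟩)
    let k : ℕ := ((k₀ : ZMod N)).val
    have hkk : ZHatLevel.level N (ZHatLevel.eta (k : ℤ)) = ZHatLevel.level N (ZHatLevel.eta k₀) := by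
      rw [ZHatLevel.level_eta, ZHatLevel.level_eta, Int.cast_natCast, ZMod.natCast_zmod_val]
    have h1 : ZHatLevel.level N (Λ (⟨y, hy⟩ * (y₁ ^ k)⁻¹)) = 1 := by
      rw [map_mul, map_inv, map_mul, map_inv, hΛpow, hkk, ← hk₀, mul_inv_cancel]
    obtain ⟨t, ht⟩ := (ZHatLevel.level_eq_one_iff_exists_pow N _).1 h1
    obtain ⟨w, hw⟩ := hΛs t
    refine ⟨k, ?_⟩
    -- `y · y₁^{-k} · w^{-N} ∈ Ker toEll`
    have h2 : Λ (⟨y, hy⟩ * (y₁ ^ k)⁻¹ * (w ^ (N : ℕ))⁻¹) = 1 := by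
      rw [map_mul, map_inv, map_pow, hw, ht, mul_inv_cancel]
    rw [hker] at h2
    have h3 : Thm16Sub.toEll D y * (Thm16Sub.toEll D (y₁ : D.PiTemp) ^ k)⁻¹ =
        Thm16Sub.toEll D (w : D.PiTemp) ^ (N : ℕ) := by
      rw [Subgroup.coe_mul, Subgroup.coe_mul, Subgroup.coe_inv, Subgroup.coe_inv, Subgroup.coe_pow,
        Subgroup.coe_pow, map_mul, map_mul, map_inv, map_inv, map_pow, map_pow, mul_inv_eq_one] at h2
      exact h2
    rw [h3]
    exact Subgroup.subset_closure ⟨Thm16Sub.toEll D (w : D.PiTemp), ⟨(w : D.PiTemp), w.2, rfl⟩, rfl⟩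
  · -- `hord` (→): `toEll y₁^k ∈ N·(Δ^tp_Y)^ell ⇒ N ∣ k`
    obtain ⟨w, hw, hwl⟩ := hclos _ hk
    have h1 : Thm16Sub.toEll D ((y₁ ^ k * w⁻¹ : ↥D.DtpY) : D.PiTemp) = 1 := by
      rw [Subgroup.coe_mul, Subgroup.coe_inv, Subgroup.coe_pow, map_mul, map_inv, map_pow, hw, mul_inv_cancel]
    rw [← hker, map_mul, map_inv, mul_inv_eq_one, hΛpow] at h1
    have h2 : ZHatLevel.level N (ZHatLevel.eta (k : ℤ)) = 1 := by rw [h1, hwl]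
    rw [ZHatLevel.level_eta, ← ofAdd_zero, Multiplicative.ofAdd.injective.eq_iff, Int.cast_natCast,
      ZMod.natCast_eq_zero_iff] at h2
    exact h2
  · -- `hord` (←): `N ∣ k ⇒ toEll y₁^k = (toEll (y₁^j))^N`
    obtain ⟨j, rfl⟩ := hk
    rw [mul_comm, pow_mul]
    exact Subgroup.subset_closure ⟨Thm16Sub.toEll D (y₁ : D.PiTemp) ^ j,
      ⟨(y₁ : D.PiTemp) ^ j, D.DtpY.pow_mem y₁.2 j, by rw [map_pow]⟩, rfl⟩

/-! ### Part B: the Tate-twist clause `htw` from a mod-`N` cyclotome datum -/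

/-- `[z, y] ∈ Ker toEll` for `z, y ∈ Δ^tp_X` (`(Δ^tp_X)^ell` is abelian: `ι[z,y] ∈ [Δ_X,Δ_X]`).
[cite: MochizukiEtTh2009, §1 p.12] -/
theorem commutator_mem_ker_toEll {z y : D.PiTemp} (hz : z ∈ D.DeltaTemp) (hy : y ∈ D.DeltaTemp) :
    ⁅z, y⁆ ∈ (Thm16Sub.toEll D).ker := by
  show ⁅z, y⁆ ∈ (D.thetaToEll.comp D.toTheta).ker
  rw [D.ker_toEll, Subgroup.mem_comap, map_commutatorElement]
  have hιΔ : ∀ {t : D.PiTemp}, t ∈ D.DeltaTemp → D.toHat.toMonoidHom t ∈ D.DeltaHat := by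
    intro t ht
    have : t ∈ D.DeltaHat.comap D.toHat.toMonoidHom := by
      rw [SettingCompletion.comap_deltaHat D.toTemperedCurve]; exact ht
    exact this
  exact Subgroup.le_topologicalClosure _ (Subgroup.commutator_mem_commutator (hιΔ hz) (hιΔ hy))

/-- `θ[z, y] ∈ Δ_Θ` for `z, y ∈ Δ^tp_X`. [cite: MochizukiEtTh2009, §1 p.12] -/
theorem toTheta_commutatorElement_mem_deltaTheta {z y : D.PiTemp} (hz : z ∈ D.DeltaTemp) (hy : y ∈ D.DeltaTemp) :
    D.toTheta ⁅z, y⁆ ∈ D.DeltaTheta := by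
  have h := D.commutator_mem_ker_toEll hz hy
  rw [MonoidHom.mem_ker] at h
  exact h

/-- **The Tate-twist clause `htw` of `IsTateOrigin.tate`, DERIVED from a mod-`N` cyclotome datum** ([EtTh] p. 13
«`G_{K_N}` acts trivially on `(Δ^tp_X)^ell/N·(Δ^tp_Y)^ell`», p. 12 «`(Δ^tp_Y)^ell ≅ Ẑ(1)`», «`(Ẑ(1) ≅) Δ_Θ`»):
under the freeness guard, the closedness binder `hYcl`, and a `Π^tp_X`-equivariant identification
`μ : Δ_Θ ⊗ ℤ/N ≅ μ_N` (`CyclotomeMod 1 N`), for every `g ∈ Π^tp_X` acting on the primitive `N`-th root `ζ` by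
`ζ ↦ ζ^k` and every `y ∈ Δ^tp_Y`: `toEll (g y g⁻¹) · (toEll y ^ k)⁻¹ ∈ N·(Δ^tp_Y)^ell`.  PROOF: the commutator
pairing `c(y) = θ[z, y]` (`z ↦ 1 ∈ Z`) is a homomorphism `Δ^tp_Y → Δ_Θ` (centrality), kills exactly
`Ker toEll ∩ Δ^tp_Y` (abc-iut-w5-d006's non-degeneracy), is onto (Heisenberg surjectivity) and `Π^tp_X`-equivariant
(`(Δ^tp_Y)^Θ` abelian); `μ.red_conj` then reads the conjugation action on `Δ_Θ/N` as the `k`-th power.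
[cite: MochizukiEtTh2009, §1 p.13] -/
theorem IsEtThOrigin.tate_twist_of_cyclotomeMod (hO : D.IsEtThOrigin)
    (hYcl : (D.DtpY.map D.toHat.toMonoidHom).topologicalClosure ≤
      D.DtpY.map D.toHat.toMonoidHom ⊔ (⁅⁅D.DeltaHat, D.DeltaHat⁆, D.DeltaHat⁆).topologicalClosure)
    {N : ℕ+} (μ : D.CyclotomeMod 1 N) {ζ : PadicAlgCl p} (hζ : IsPrimitiveRoot ζ (N : ℕ)) :
    ∀ (g : D.PiTemp) (k : ℕ), D.aug g ζ = ζ ^ k → ∀ y ∈ D.DtpY,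
      Thm16Sub.toEll D (g * y * g⁻¹) * (Thm16Sub.toEll D y ^ k)⁻¹ ∈ Thm16Sub.ellPowersY D N := by
  classical
  haveI : NeZero (N : ℕ) := ⟨N.ne_zero⟩
  haveI hΔn : D.DeltaTemp.Normal := by
    show D.aug.toMonoidHom.ker.Normal; infer_instance
  haveI : D.DtpY.Normal := by unfold DtpY GtpY; infer_instance
  -- a lift `z ∈ Δ^tp_X` of the generator `1 ∈ Z`
  obtain ⟨⟨z, hz⟩, hzZ'⟩ := D.toZ_delta_surjective (Multiplicative.ofAdd 1)
  have hzZ : D.toZ z = Multiplicative.ofAdd 1 := hzZ'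
  have hzΔ : z ∈ D.DeltaTemp := hz
  -- membership bookkeeping
  have hιΔ : ∀ {t : D.PiTemp}, t ∈ D.DeltaTemp → D.toHat.toMonoidHom t ∈ D.DeltaHat := by
    intro t ht
    have : t ∈ D.DeltaHat.comap D.toHat.toMonoidHom := by
      rw [SettingCompletion.comap_deltaHat D.toTemperedCurve]; exact ht
    exact this
  have hYΔ : ∀ {y : D.PiTemp}, y ∈ D.DtpY → y ∈ D.DeltaTemp := fun hy => hy.2
  -- centrality of `Δ_Θ` in `(Δ^tp_X)^Θ`
  have hcentral : ∀ {s : D.GtpTheta}, s ∈ D.DeltaTheta → ∀ {t : D.PiTemp}, t ∈ D.DeltaTemp →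
      D.toTheta t * s * (D.toTheta t)⁻¹ = s := by
    intro s hs t ht
    have h := D.ker_thetaToEll_central s hs (D.toTheta t) ⟨t, ht, rfl⟩
    rw [← h, mul_inv_cancel_right]
  -- the pairing `c : Δ^tp_Y → (Π^tp_X)^Θ`, `y ↦ θ[z, y]`
  let c : ↥D.DtpY →* D.GtpTheta :=
    { toFun := fun y => D.toTheta ⁅z, (y : D.PiTemp)⁆
      map_one' := by rw [OneMemClass.coe_one, commutatorElement_one_right, map_one]
      map_mul' := fun y y' => by
        have hid : ⁅z, ((y * y' : ↥D.DtpY) : D.PiTemp)⁆ =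
            ⁅z, (y : D.PiTemp)⁆ * ((y : D.PiTemp) * ⁅z, (y' : D.PiTemp)⁆ * (y : D.PiTemp)⁻¹) := by
          rw [Subgroup.coe_mul]; simp only [commutatorElement_def]; group
        rw [hid, map_mul, map_mul, map_mul, map_inv,
          hcentral (D.toTheta_commutatorElement_mem_deltaTheta hzΔ (hYΔ y'.2)) (hYΔ y.2)] }
  have hc : ∀ y : ↥D.DtpY, c y = D.toTheta ⁅z, (y : D.PiTemp)⁆ := fun y => rfl
  have hcΔ : ∀ y : ↥D.DtpY, c y ∈ D.DeltaTheta := fun y =>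
    D.toTheta_commutatorElement_mem_deltaTheta hzΔ (hYΔ y.2)
  -- kernel of `c` = `Ker toEll ∩ Δ^tp_Y`
  have hcker : ∀ y : ↥D.DtpY, c y = 1 ↔ Thm16Sub.toEll D (y : D.PiTemp) = 1 := by
    intro y
    rw [hc, ← MonoidHom.mem_ker, D.ker_toTheta, Subgroup.mem_comap, map_commutatorElement]
    show _ ↔ (D.thetaToEll.comp D.toTheta) (y : D.PiTemp) = 1
    rw [← MonoidHom.mem_ker, D.ker_toEll, Subgroup.mem_comap]
    constructor
    · exact hO.toHat_mem_commutatorClosure_of_commutator_mem D hzΔ hzZ y.2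
    · intro hyK
      have hAK : ⁅D.DeltaHat, (⁅D.DeltaHat, D.DeltaHat⁆).topologicalClosure⁆ ≤
          (⁅⁅D.DeltaHat, D.DeltaHat⁆, D.DeltaHat⁆).topologicalClosure := by
        refine (commutator_topologicalClosure_right_le _ _).trans (le_of_eq ?_)
        rw [Subgroup.commutator_comm D.DeltaHat ⁅D.DeltaHat, D.DeltaHat⁆]
      exact hAK (Subgroup.commutator_mem_commutator (hιΔ hzΔ) hyK)
  -- `c` is ONTO `Δ_Θ` (Heisenberg surjectivity, needs `hYcl`)
  have hcsurj : ∀ s ∈ D.DeltaTheta, ∃ y : ↥D.DtpY, c y = s := by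
    intro s hs
    obtain ⟨y, hy, hys⟩ := D.exists_commutator_of_mem_deltaTheta_of_origin hO hYcl hzΔ hzZ hs
    exact ⟨⟨y, hy⟩, by rw [hc, commutatorElement_def]; exact hys⟩
  -- `c` is `Π^tp_X`-equivariant
  have hcconj : ∀ (g : D.PiTemp) (y : ↥D.DtpY),
      c ⟨g * (y : D.PiTemp) * g⁻¹, Subgroup.Normal.conj_mem inferInstance _ y.2 g⟩ =
        D.toTheta g * c y * (D.toTheta g)⁻¹ := by
    intro g y
    -- `m := g z g⁻¹ z⁻¹ ∈ Δ^tp_Y`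
    have hmΔ : g * z * g⁻¹ * z⁻¹ ∈ D.DeltaTemp :=
      D.DeltaTemp.mul_mem (hΔn.conj_mem _ hzΔ g) (D.DeltaTemp.inv_mem hzΔ)
    have hmY : g * z * g⁻¹ * z⁻¹ ∈ D.DtpY := by
      refine ⟨?_, hmΔ⟩
      show g * z * g⁻¹ * z⁻¹ ∈ D.toZ.ker
      rw [MonoidHom.mem_ker, map_mul, map_mul, map_mul, map_inv, map_inv, mul_inv_cancel_comm, mul_inv_cancel]
    have hy'Y : g * (y : D.PiTemp) * g⁻¹ ∈ D.DtpY := Subgroup.Normal.conj_mem inferInstance _ y.2 g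
    -- `g [z,y] g⁻¹ = m [z, y'] m⁻¹ · [m, y']` with `y' = g y g⁻¹`
    have hid : g * ⁅z, (y : D.PiTemp)⁆ * g⁻¹ =
        (g * z * g⁻¹ * z⁻¹) * ⁅z, g * (y : D.PiTemp) * g⁻¹⁆ * (g * z * g⁻¹ * z⁻¹)⁻¹ *
          ⁅g * z * g⁻¹ * z⁻¹, g * (y : D.PiTemp) * g⁻¹⁆ := by
      simp only [commutatorElement_def]; group
    have h1 : D.toTheta g * c y * (D.toTheta g)⁻¹ = D.toTheta (g * ⁅z, (y : D.PiTemp)⁆ * g⁻¹) := by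
      rw [hc, map_mul, map_mul, map_inv]
    rw [h1, hid, map_mul, map_mul, map_mul, map_inv,
      hcentral (D.toTheta_commutatorElement_mem_deltaTheta hzΔ (hYΔ hy'Y)) hmΔ]
    -- `θ[m, y'] = 1`: `(Δ^tp_Y)^Θ` is abelian
    have hab : D.toTheta ⁅g * z * g⁻¹ * z⁻¹, g * (y : D.PiTemp) * g⁻¹⁆ = 1 := by
      rw [map_commutatorElement, commutatorElement_eq_one_iff_mul_comm]
      exact D.dtpYTheta_comm hO _ ⟨_, hmY, rfl⟩ _ ⟨_, hy'Y, rfl⟩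
    rw [hab, mul_one]
    exact hc _
  -- `aug g` acts on `μ_N` as the `k`-th power
  intro g k hgζ y hy
  have hgζ' : (D.aug.toMonoidHom g) ζ = ζ ^ k := hgζ
  have hpowk : ∀ w : MuN p N, galMuN p N (D.aug.toMonoidHom g) w = w ^ k := by
    intro w
    have hζu : IsUnit ζ := hζ.isUnit N.ne_zero
    have hζ' : IsPrimitiveRoot hζu.unit (N : ℕ) :=
      IsPrimitiveRoot.coe_units_iff.mp (by rw [IsUnit.unit_spec]; exact hζ)
    have hwmem : (w : (PadicAlgCl p)ˣ) ∈ Subgroup.zpowers hζu.unit := by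
      rw [hζ'.zpowers_eq]; exact w.2
    obtain ⟨j, hj⟩ := Subgroup.mem_zpowers_iff.mp hwmem
    have hwval : ((w : (PadicAlgCl p)ˣ) : PadicAlgCl p) = ζ ^ j := by
      rw [← hj, Units.val_zpow_eq_zpow_val, IsUnit.unit_spec]
    apply Subtype.ext
    apply Units.ext
    rw [galMuN_apply_coe, Subgroup.coe_pow, Units.val_pow_eq_pow_val, hwval, map_zpow₀, hgζ',
      ← zpow_natCast, ← zpow_mul, ← zpow_natCast, ← zpow_mul, mul_comm]
  -- the element `w := g y g⁻¹ · (y^k)⁻¹ ∈ Δ^tp_Y` and its pairing value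
  have hy'Y : g * y * g⁻¹ ∈ D.DtpY := Subgroup.Normal.conj_mem inferInstance _ hy g
  let x : ↥(D.lDeltaTheta 1) := ⟨c ⟨y, hy⟩, c ⟨y, hy⟩, hcΔ _, pow_one _⟩
  let x' : ↥(D.lDeltaTheta 1) := ⟨c ⟨g * y * g⁻¹, hy'Y⟩, c _, hcΔ _, pow_one _⟩
  have hxconj : (x' : D.GtpTheta) = D.toTheta g * x * (D.toTheta g)⁻¹ := hcconj g ⟨y, hy⟩
  have hred : μ.red x' = μ.red (x ^ k) := by
    have h1 : x' = ⟨D.toTheta g * x * (D.toTheta g)⁻¹, (D.lDeltaTheta_normal 1).conj_mem _ x.2 _⟩ :=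
      Subtype.ext hxconj
    rw [h1, μ.red_conj, hpowk, map_pow]
  have hred1 : μ.red (x' * (x ^ k)⁻¹) = 1 := by rw [map_mul, map_inv, hred, mul_inv_cancel]
  obtain ⟨s, hs⟩ := (μ.red_ker _).1 hred1
  -- `c (g y g⁻¹ · (y^k)⁻¹) = s^N` with `s ∈ Δ_Θ`
  have hsΔ : (s : D.GtpTheta) ∈ D.DeltaTheta := by
    obtain ⟨t, ht, hts⟩ := s.2
    rw [← hts, pow_one]; exact ht
  have hcw : c ⟨g * y * g⁻¹, hy'Y⟩ * (c ⟨y, hy⟩ ^ k)⁻¹ = (s : D.GtpTheta) ^ (N : ℕ) := by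
    have h := congr_arg Subtype.val hs
    simp only [Subgroup.coe_mul, Subgroup.coe_inv, Subgroup.coe_pow] at h
    exact h
  -- `s = c y₀`; hence `toEll (w · y₀^{-N}) = 1`
  obtain ⟨y₀, hy₀⟩ := hcsurj _ hsΔ
  have hker1 : c (⟨g * y * g⁻¹, hy'Y⟩ * (⟨y, hy⟩ ^ k)⁻¹ * (y₀ ^ (N : ℕ))⁻¹) = 1 := by
    rw [map_mul, map_mul, map_inv, map_inv, map_pow, map_pow, hcw, hy₀, mul_inv_cancel]
  rw [hcker] at hker1
  have hfinal : Thm16Sub.toEll D (g * y * g⁻¹) * (Thm16Sub.toEll D y ^ k)⁻¹ =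
      Thm16Sub.toEll D (y₀ : D.PiTemp) ^ (N : ℕ) := by
    rw [Subgroup.coe_mul, Subgroup.coe_mul, Subgroup.coe_inv, Subgroup.coe_inv, Subgroup.coe_pow,
      Subgroup.coe_pow, map_mul, map_mul, map_inv, map_inv, map_pow, map_pow, mul_inv_eq_one] at hker1
    exact hker1
  rw [hfinal]
  exact Subgroup.subset_closure ⟨Thm16Sub.toEll D (y₀ : D.PiTemp), ⟨(y₀ : D.PiTemp), y₀.2, rfl⟩, rfl⟩

/-- **K3 leaf L04 with the Tate-twist slot FILLED** ([EtTh] p. 13 «`G_{K_N}` acts trivially on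
`(Δ^tp_X)^ell/N·(Δ^tp_Y)^ell`» as the characterisation of `G_{K_N}`): abc-iut-w5-d051's
`Thm16Sub.gknIsKernelOfAction_of_tate` with `htw` supplied by `tate_twist_of_cyclotomeMod`; the remaining inputs are
a generator `y₁` with its order clause (`exists_generator_hord` produces one), a lift `z` of `1 ∈ Z`, and the
Kummer-class clause `hkum` for `q_X^{1/N}` — the genuinely arithmetic third of the origin clause.
[cite: MochizukiEtTh2009, §1 p.13] -/
theorem IsEtThOrigin.gknIsKernelOfAction_of_cyclotomeMod (hO : D.IsEtThOrigin)
    (hYcl : (D.DtpY.map D.toHat.toMonoidHom).topologicalClosure ≤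
      D.DtpY.map D.toHat.toMonoidHom ⊔ (⁅⁅D.DeltaHat, D.DeltaHat⁆, D.DeltaHat⁆).topologicalClosure)
    {N : ℕ+} (μ : D.CyclotomeMod 1 N) {ζ r : PadicAlgCl p} (hζ : IsPrimitiveRoot ζ (N : ℕ))
    (hr : r ^ (N : ℕ) = D.qX) {y₁ z : D.PiTemp} (hy₁ : y₁ ∈ D.DtpY) (hz : z ∈ D.DeltaTemp)
    (hzZ : D.toZ z = Multiplicative.ofAdd 1)
    (hord : ∀ k : ℕ, Thm16Sub.toEll D y₁ ^ k ∈ Thm16Sub.ellPowersY D N ↔ (N : ℕ) ∣ k)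
    (hkum : ∀ (g : D.PiTemp) (m : ℕ), D.aug g r = ζ ^ m * r →
      Thm16Sub.toEll D (g * z * g⁻¹ * z⁻¹) * (Thm16Sub.toEll D y₁ ^ m)⁻¹ ∈ Thm16Sub.ellPowersY D N) :
    Thm16Sub.GKNIsKernelOfAction D N :=
  Thm16Sub.gknIsKernelOfAction_of_tate D N hy₁ hz hzZ hζ hr hord (hO.tate_twist_of_cyclotomeMod D hYcl μ hζ) hkum

end ThetaSetting

end Literature.AnabelianGeometry.EtaleTheta

end
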